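import Summits.CriticalPhenomena.PercolationContinuityZ3.Theorems.PercNearOneGluingNoHeavyQuantGluedCheapPool
import Summits.CriticalPhenomena.PercolationContinuityZ3.Theorems.PercNearOneGluingNoHeavyQuantGluedWindowIneq
import HarnessLib

/-!
# QUANT lane R8, T-DEC: LEMMA W's pair condition PROVED in its main cell — a light window pair below a cheap atom satisfies its pair
# condition whenever all three copies of the low atom are low and the pair is still light at the raised target (no `GluedLemmaW`
# hypothesis; arm-1 gen 59, architect)

builds on p205010 (kernel theorem, internal audit signed; external expert review pending)

Support file (`--supports stmt-CriticalPhenomena-4575`), QUANT lane seat prim-quant-arm-1 (gen 59, architect); memo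
`run/shared/lean/prim/quant/prim-quant-arm-1-g59/ARCH-G59.md`.  Theorems only; standard axioms, no sorries, no definitions.

WHAT.  Arm-1 g58 reduced the band of the glued-piece slice (hence, numerically, the law-level node `SiblingStep`) at the trivial gate to the
flow conjecture `LawDec.GluedLemmaW`, used only through its dual consequence `gluedPullback_windowPair_of_lemmaW`: for a price system
`(α, p)` of the image positions at `(y, T, j)`, a light window pair `(l, h)` and an atom `c ∈ [h, min(j,B)]` CHEAP w.r.t. some position `l*`
(`−Ψ(c)·y < (1−y)·Ψ(l*)`), the pair condition `(1−γ)Ψ(l) + γΨ(h) ≤ 0`.  This file proves that consequence WITHOUT the conjecture in the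
regime where the image of the pair can actually fail to transfer (memo §1: `2(l+r+k) < T`, `l+r+k ≤ j` — all three copies of `l` are low;
in every sampled configuration outside it the image `{l,h;γ} ∗ t` is flow-feasible by itself except when `l+r+k` is a non-low mid, §4) and
the pair is still LIGHT and compatible at `T` (`T < l + h`, `T − 2l ≤ y(h − l)`; then so are the higher copies):
**`gluedPullback_windowPair_lowTriple_light`**.  No flow is constructed: (C) the cheap pool bound `pool_bound` (the giant copies of `h`
absorb every copy of `l` at the rate `usage(·, c) ≤ usage(·, h)`), so each copy `L_s` has `α(L_s) ≤ usage(L_s, h)·Q` with `Q` the least of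
the column price `min(p h, p(h+r))` (resp. `p h` when `h + r` is a giant) and the pool price; (P) the chord inequality `GluedWindow.p2l`:
`(1−γ)·Σ_s t_s usage(L_s, h) ≤ γ` — the t-average of the three copies' light rates into `h` is at most the pair's own rate `γ/(1−γ)`
(needs only `h − l > r + k`, `Δ = T − T₀ ≤ m`); (W) `Q ≤` each price of `h`'s copies.  Several hypotheses of the g58 interface turned
out to be unnecessary here (`x ≤ qg`, the lower band inequality, `xB ≤ S ≤ B`, the lowness of `l*`) and are dropped.
* `ratio_anti_low` — the credit ratio `(T − 2L)/(h − L)` is antitone in the low `L < h` when `T ≤ 2h`;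
* `usage_light_eq` — closed form `usage = (y² + (1−y)ρ)/(1 − y² − (1−y)ρ)` of a light compatible mid pair (`pairGate_eq_light`).
REMAINING CELLS of the same regime (memo §3, all reduced to named real inequalities of `…QuantGluedWindowIneq` by the two-column
breakpoint lemma): `l` heavy or incompatible for `h` at `T` (`heavy_row_ineq`, `inc_row_ineq`), and both `l`, `l+r` heavy
(`TwoHeavyRowsIneq`, open); plus the two-row regime `l+r+k` a non-low mid (§4).

HONEST STATUS.  `GluedLemmaW` (as a flow statement), `GluedDominatedMass`, the band, `SiblingStep`, `FarTreeRow` OPEN; RATE class (log\*) /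
honest sentence of `run/shared/lean/prim/quant/README.md` unchanged.  [this work].  Nothing here is cited as a published result.  The gluing
rows served [cite: KozmaNitzan2024, Conjecture 3 (p. 15)]; product measure [cite: Grimmett1999, §1.3 p. 10].
-/

noncomputable section

open scoped BigOperators

namespace Summit.CriticalPhenomena.PercolationContinuityZ3.Theorems
namespace Quant

open Finset

namespace LawDec

/-- the credit ratio of a pair is antitone in the low below a non-low absorber: `L ≤ L' < h`, `T ≤ 2h` ⟹
`(T − 2L')/(h − L') ≤ (T − 2L)/(h − L)`. [this work] -/
theorem ratio_anti_low (T : ℝ) (L L' h : ℝ) (hLL : L ≤ L') (hL'h : L' < h) (hT : T ≤ 2 * h) :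
    (T - 2 * L') / (h - L') ≤ (T - 2 * L) / (h - L) := by
  rw [div_le_div_iff₀ (by linarith) (by linarith)]
  nlinarith [mul_nonneg (sub_nonneg.2 hLL) (show (0:ℝ) ≤ 2 * h - T by linarith)]

/-- usage of a LIGHT compatible mid pair in closed form: `h ≤ j`, `ρ = (T − 2L)/(h − L) ≤ y`, `0 ≤ y` ⟹
`usage y T j L h = (y² + (1−y)ρ)/(1 − (y² + (1−y)ρ))`. [this work] -/
theorem usage_light_eq (y T : ℝ) (j L h : ℕ) (hy0 : 0 ≤ y) (hhj : h ≤ j)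
    (hρ : (T - 2 * (L : ℝ)) / ((h : ℝ) - L) ≤ y) :
    usage y T j L h = (y ^ 2 + (1 - y) * ((T - 2 * (L : ℝ)) / ((h : ℝ) - L)))
      / (1 - (y ^ 2 + (1 - y) * ((T - 2 * (L : ℝ)) / ((h : ℝ) - L)))) := by
  have hnj : ¬ (j + 1 ≤ h) := by omega
  simp only [usage, gateOf, if_neg hnj, pairGate_eq_light y T L h hy0 hρ]

/-- the point mass `δ_K` -/
local notation3 "δ[" K "]" => (fun k : ℕ => if k = (K : ℕ) then (1 : ℝ) else 0)

/-- the two-point law `{lo, lo+K; g}` -/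
local notation3 "TPL[" lo ", " K ", " g "]" => lconv lo K δ[lo] (gate δ[K] g)

set_option maxHeartbeats 1600000 in
/-- **THE LIGHT WINDOW PAIR CONDITION BELOW A CHEAP ATOM — CASE: all three copies of the low atom are low and the pair is still
light and compatible at the raised target** (no `GluedLemmaW` hypothesis).  Band frame and price system exactly as in
`gluedPullback_windowPair_of_lemmaW`; additionally `2(l+r+k) < T`, `l + r + k ≤ j` (the only regime in which the image of the pair can
fail to transfer, memo ARCH-G59 §1) and `T < l + h`, `(T − 2l) ≤ y·(h − l)` (the pair `(l, h)` is light and compatible at `T` itself).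
Then `(1−γ)·Ψ(l) + γ·Ψ(h) ≤ 0`.  Proof: the cheap pool bound (`pool_bound`) and the chord inequality `p2l`. [this work] -/
theorem gluedPullback_windowPair_lowTriple_light (x a q g S : ℝ) (B r k j l h c ls : ℕ) (α p : ℕ → ℝ)
    (hx0 : 0 < x) (hx1 : x < 1) (ha0 : 0 < a) (ha1 : a ≤ 1) (hq0 : 0 < q) (hq1 : q < 1) (hg0 : 0 ≤ g) (hg1 : g ≤ 1) (hr : 1 ≤ r) (hk : 1 ≤ k)
    (hband1 : 2 * (r : ℝ) < q * ((r : ℝ) + k * g)) (hjM : j < B + (r + k))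
    (hlh : l < h) (hhB : h ≤ B) (hhj : h ≤ j) (hwin : j < h + r + k)
    (hlight : pairGate (a * x) (a * S) l h < a * x)
    (hhc : h ≤ c) (hcB : c ≤ B) (hcj : c ≤ j)
    (hp : ∀ h, 0 ≤ p h)
    (hαp : ∀ l' h', l' ≤ j → 2 * (l' : ℝ) < a * (S + q * ((r : ℝ) + k * g)) → h' ≤ B + (r + k) →
      (j + 1 ≤ h' ∨ a * (S + q * ((r : ℝ) + k * g)) < (l' : ℝ) + h') →
      α l' ≤ usage (a * x) (a * (S + q * ((r : ℝ) + k * g))) j l' h' * p h')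
    (hcheap : -(gluedPullback (a * (S + q * ((r : ℝ) + k * g))) q g j r k α p c) * (a * x)
      < (1 - a * x) * gluedPullback (a * (S + q * ((r : ℝ) + k * g))) q g j r k α p ls)
    (hB3 : 2 * ((l : ℝ) + r + k) < a * (S + q * ((r : ℝ) + k * g))) (hB3' : l + r + k ≤ j)
    (hcompT : a * (S + q * ((r : ℝ) + k * g)) < (l : ℝ) + h)
    (hlightT : a * (S + q * ((r : ℝ) + k * g)) - 2 * (l : ℝ) ≤ (a * x) * ((h : ℝ) - l)) :
    (1 - pairGate (a * x) (a * S) l h) * gluedPullback (a * (S + q * ((r : ℝ) + k * g))) q g j r k α p l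
      + pairGate (a * x) (a * S) l h * gluedPullback (a * (S + q * ((r : ℝ) + k * g))) q g j r k α p h ≤ 0 := by
  -- names
  set y : ℝ := a * x with hy
  set T : ℝ := a * (S + q * ((r : ℝ) + k * g)) with hT
  set T₀ : ℝ := a * S with hT₀
  set t0 : ℝ := 1 - q with ht0
  set t1 : ℝ := q * (1 - g) with ht1
  set t2 : ℝ := q * g with ht2
  clear_value y T T₀ t0 t1 t2
  have hy0 : 0 < y := by rw [hy]; exact mul_pos ha0 hx0
  have hyx : y ≤ x := by rw [hy]; nlinarith
  have hy1 : y < 1 := by linarith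
  have h1y : 0 < 1 - y := by linarith
  have ht0p : 0 ≤ t0 := by rw [ht0]; linarith
  have ht1p : 0 ≤ t1 := by rw [ht1]; exact mul_nonneg hq0.le (by linarith)
  have ht2p : 0 ≤ t2 := by rw [ht2]; exact mul_nonneg hq0.le hg0
  have hts : t0 + t1 + t2 = 1 := by rw [ht0, ht1, ht2]; ring
  -- target increment Δ = T − T₀ = a·m ≤ m = t1 r + t2 (r+k) ≤ r + k
  have hmK : q * ((r : ℝ) + k * g) ≤ (r : ℝ) + k := by
    have : (0:ℝ) ≤ (k : ℝ) * (1 - g) := mul_nonneg (by positivity) (by linarith)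
    nlinarith [mul_le_mul_of_nonneg_left hq1.le (show (0:ℝ) ≤ (r : ℝ) + k * g by positivity)]
  have hΔ0 : T₀ ≤ T := by rw [hT, hT₀]; nlinarith [mul_nonneg ha0.le (show (0:ℝ) ≤ q * ((r:ℝ) + k * g) by positivity)]
  have hΔm : T - T₀ ≤ t1 * r + t2 * ((r : ℝ) + k) := by
    rw [hT, hT₀, ht1, ht2]
    have h1 : a * (q * ((r : ℝ) + k * g)) ≤ q * ((r : ℝ) + k * g) := by
      have := mul_le_mul_of_nonneg_right ha1 (show (0:ℝ) ≤ q * ((r:ℝ) + k * g) by positivity)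
      linarith
    have e : q * (1 - g) * (r : ℝ) + q * g * ((r : ℝ) + k) = q * ((r : ℝ) + k * g) := by ring
    have e2 : a * (S + q * ((r : ℝ) + k * g)) - a * S = a * (q * ((r : ℝ) + k * g)) := by ring
    linarith
  -- geometry: d = h − l > K, 2h > T, all l-copies low, all h- and c-copies non-low
  have hlh' : (l : ℝ) < h := by exact_mod_cast hlh
  have hK0 : (0:ℝ) ≤ (r : ℝ) + k := by positivity
  have hmK' : t1 * r + t2 * ((r : ℝ) + k) ≤ (r : ℝ) + k := by
    have a1 : t1 * (r : ℝ) ≤ t1 * ((r : ℝ) + k) := mul_le_mul_of_nonneg_left (by linarith [show (0:ℝ) ≤ k from Nat.cast_nonneg k]) ht1p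
    have a2 : 0 ≤ t0 * ((r : ℝ) + k) := mul_nonneg ht0p hK0
    have e3 : t1 * ((r : ℝ) + k) + t2 * ((r : ℝ) + k) + t0 * ((r : ℝ) + k) = (r : ℝ) + k := by
      calc t1 * ((r : ℝ) + k) + t2 * ((r : ℝ) + k) + t0 * ((r : ℝ) + k) = (t0 + t1 + t2) * ((r : ℝ) + k) := by ring
        _ = (r : ℝ) + k := by rw [hts, one_mul]
    linarith
  have hΔK : T - T₀ ≤ (r : ℝ) + k := le_trans hΔm hmK'
  have hdK : ((r : ℝ) + k) < (h : ℝ) - l := by linarith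
  have h2h : T < 2 * (h : ℝ) := by linarith
  have hL0 : l ≤ j ∧ 2 * (l : ℝ) < T := ⟨by omega, by linarith⟩
  have hL1 : l + r ≤ j ∧ 2 * ((l + r : ℕ) : ℝ) < T := ⟨by omega, by push_cast; linarith [show (0:ℝ) ≤ k from Nat.cast_nonneg k]⟩
  have hL2 : l + r + k ≤ j ∧ 2 * ((l + r + k : ℕ) : ℝ) < T := ⟨hB3', by push_cast; linarith⟩
  have nonlow : ∀ v : ℕ, h ≤ v → ¬ (v ≤ j ∧ 2 * (v : ℝ) < T) := by
    intro v hv ⟨_, hv2⟩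
    have : (h : ℝ) ≤ v := by exact_mod_cast hv
    linarith
  -- the pullback values
  have cL : ∀ v : ℕ, (v ≤ j ∧ 2 * (v : ℝ) < T) → coefAt T j α p v = α v := fun v hv => by simp only [coefAt, if_pos hv]
  have cH : ∀ v : ℕ, h ≤ v → coefAt T j α p v = -p v := fun v hv => by simp only [coefAt, if_neg (nonlow v hv)]
  have eΨl : gluedPullback T q g j r k α p l = t0 * α l + t1 * α (l + r) + t2 * α (l + r + k) := by
    simp only [gluedPullback, cL l hL0, cL (l + r) hL1, cL (l + r + k) hL2, ht0, ht1, ht2]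
  have eΨh : gluedPullback T q g j r k α p h = -(t0 * p h + t1 * p (h + r) + t2 * p (h + r + k)) := by
    simp only [gluedPullback, cH h le_rfl, cH (h + r) (by omega), cH (h + r + k) (by omega), ht0, ht1, ht2]; ring
  have eΨc : gluedPullback T q g j r k α p c = -(t0 * p c + t1 * p (c + r) + t2 * p (c + r + k)) := by
    simp only [gluedPullback, cH c hhc, cH (c + r) (by omega), cH (c + r + k) (by omega), ht0, ht1, ht2]; ring
  -- the pool price P* = least price among the giant copies {h+r+k, c+r+k, (h+r), (c+r)}
  obtain ⟨q1, hq1d⟩ : ∃ q1 : ℝ, q1 = if h + r ≤ j then p (h + r + k) else p (h + r) := ⟨_, rfl⟩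
  obtain ⟨q2, hq2d⟩ : ∃ q2 : ℝ, q2 = if c + r ≤ j then p (c + r + k) else p (c + r) := ⟨_, rfl⟩
  obtain ⟨P, hP⟩ : ∃ P : ℝ, P = min (min (p (h + r + k)) (p (c + r + k))) (min q1 q2) := ⟨_, rfl⟩
  have hPH2 : P ≤ p (h + r + k) := by rw [hP]; exact le_trans (min_le_left _ _) (min_le_left _ _)
  have hPC2 : P ≤ p (c + r + k) := by rw [hP]; exact le_trans (min_le_left _ _) (min_le_right _ _)
  have hPq1 : P ≤ q1 := by rw [hP]; exact le_trans (min_le_right _ _) (min_le_left _ _)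
  have hPq2 : P ≤ q2 := by rw [hP]; exact le_trans (min_le_right _ _) (min_le_right _ _)
  have hP0 : 0 ≤ P := by
    rw [hP]; refine le_min (le_min (hp _) (hp _)) (le_min ?_ ?_)
    · rw [hq1d]; split_ifs <;> exact hp _
    · rw [hq2d]; split_ifs <;> exact hp _
  -- Ψ(ls) ≤ u·P : each candidate is a giant
  have giantBound : ∀ G : ℕ, j + 1 ≤ G → G ≤ B + (r + k) → gluedPullback T q g j r k α p ls ≤ y / (1 - y) * p G :=
    fun G hGj hGM => gluedPullback_le_giant y T q g j r k (B + (r + k)) α p hy0 hy1 hq0.le hq1.le hg0 hg1 hp hαp ls G hGj hGM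
  have hΨls : gluedPullback T q g j r k α p ls ≤ y / (1 - y) * P := by
    have u0 : 0 ≤ y / (1 - y) := div_nonneg hy0.le h1y.le
    have b1 := giantBound (h + r + k) (by omega) (by omega)
    have b2 := giantBound (c + r + k) (by omega) (by omega)
    have b3 : gluedPullback T q g j r k α p ls ≤ y / (1 - y) * q1 := by
      rw [hq1d]; split_ifs with hh
      · exact b1
      · exact giantBound (h + r) (by omega) (by omega)
    have b4 : gluedPullback T q g j r k α p ls ≤ y / (1 - y) * q2 := by
      rw [hq2d]; split_ifs with hh
      · exact b2
      · exact giantBound (c + r) (by omega) (by omega)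
    rw [hP]
    rcases min_choice (min (p (h + r + k)) (p (c + r + k))) (min q1 q2) with e | e <;> rw [e]
    · rcases min_choice (p (h + r + k)) (p (c + r + k)) with e' | e' <;> rw [e'] <;> assumption
    · rcases min_choice q1 q2 with e' | e' <;> rw [e'] <;> assumption
  -- cheapness ⟹ the average price of c's copies is below P
  have havg : t0 * p c + t1 * p (c + r) + t2 * p (c + r + k) < P := by
    have := cheap_neg_pullback_lt y _ _ P hy0 hy1 hcheap hΨls
    rw [eΨc, neg_neg] at this; exact this
  -- pool bound for each copy of the low atom (all compatible with c since compatible with h ≤ c)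
  have hC1 : j + 1 ≤ c + r ∧ P ≤ p (c + r) ∨ c + r ≤ j := by
    by_cases hcr : c + r ≤ j
    · exact Or.inr hcr
    · refine Or.inl ⟨by omega, ?_⟩
      have : q2 = p (c + r) := by rw [hq2d, if_neg hcr]
      rw [← this]; exact hPq2
  have poolB : ∀ w : ℕ, w ≤ j → 2 * (w : ℝ) < T → T < (w : ℝ) + c → α w ≤ usage y T j w c * P := by
    intro w hwj hwl hwc
    refine pool_bound y T q g P j (B + (r + k)) c r k w α p hy0 hy1 hq0.le hq1.le hg0 hg1 hp hαp hwj hwl hwc (by omega) hr ?_ hPC2 hC1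
    rw [ht0, ht1, ht2] at havg; exact havg
  -- the three copies of the low atom are light and compatible at T with respect to h
  have hd0 : (0:ℝ) < (h : ℝ) - l := by linarith
  obtain ⟨ρ₀, hρ₀⟩ : ∃ ρ₀ : ℝ, ρ₀ = (T₀ - 2 * (l : ℝ)) / ((h : ℝ) - l) := ⟨_, rfl⟩
  have hρ₀y : ρ₀ < y := by
    have : (T₀ - 2 * (l : ℝ)) / ((h : ℝ) - l) ≤ pairGate y T₀ l h := le_max_left _ _
    rw [hρ₀]; linarith
  have hγ : pairGate y T₀ l h = y ^ 2 + (1 - y) * ρ₀ := by rw [hρ₀]; exact pairGate_eq_light y T₀ l h hy0.le (by rw [← hρ₀]; exact hρ₀y.le)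
  have hL1r : ((l + r : ℕ) : ℝ) = (l : ℝ) + r := by push_cast; ring
  have hL2r : ((l + r + k : ℕ) : ℝ) = (l : ℝ) + r + k := by push_cast; ring
  -- credit ratios of the copies at T
  obtain ⟨ρa, hρa⟩ : ∃ ρa : ℝ, ρa = (T - 2 * (l : ℝ)) / ((h : ℝ) - l) := ⟨_, rfl⟩
  obtain ⟨ρb, hρb⟩ : ∃ ρb : ℝ, ρb = (T - 2 * ((l + r : ℕ) : ℝ)) / ((h : ℝ) - ((l + r : ℕ) : ℝ)) := ⟨_, rfl⟩
  obtain ⟨ρc, hρc⟩ : ∃ ρc : ℝ, ρc = (T - 2 * ((l + r + k : ℕ) : ℝ)) / ((h : ℝ) - ((l + r + k : ℕ) : ℝ)) := ⟨_, rfl⟩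
  have hρay : ρa ≤ y := by rw [hρa, div_le_iff₀ hd0]; linarith
  have hr0 : (0:ℝ) ≤ r := Nat.cast_nonneg r
  have hk0' : (0:ℝ) ≤ k := Nat.cast_nonneg k
  have hρba : ρb ≤ ρa := by
    have s1 : (l : ℝ) ≤ (l : ℝ) + r := by linarith
    have s2 : (l : ℝ) + r < (h : ℝ) := by linarith
    have := ratio_anti_low T (l : ℝ) ((l : ℝ) + r) (h : ℝ) s1 s2 h2h.le
    rw [hρb, hρa, hL1r]; exact this
  have hρca : ρc ≤ ρa := by
    have s1 : (l : ℝ) ≤ (l : ℝ) + r + k := by linarith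
    have s2 : (l : ℝ) + r + k < (h : ℝ) := by linarith
    have := ratio_anti_low T (l : ℝ) ((l : ℝ) + r + k) (h : ℝ) s1 s2 h2h.le
    rw [hρc, hρa, hL2r]; exact this
  have hρby : ρb ≤ y := le_trans hρba hρay
  have hρcy : ρc ≤ y := le_trans hρca hρay
  -- usage of the three copies into h, closed form κ = G/(1 − G), G = y² + (1−y)ρ
  have eκa : usage y T j l h = (y ^ 2 + (1 - y) * ρa) / (1 - (y ^ 2 + (1 - y) * ρa)) := by
    rw [hρa]; exact usage_light_eq y T j l h hy0.le hhj (by rw [← hρa]; exact hρay)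
  have eκb : usage y T j (l + r) h = (y ^ 2 + (1 - y) * ρb) / (1 - (y ^ 2 + (1 - y) * ρb)) := by
    rw [hρb]; exact usage_light_eq y T j (l + r) h hy0.le hhj (by rw [← hρb]; exact hρby)
  have eκc : usage y T j (l + r + k) h = (y ^ 2 + (1 - y) * ρc) / (1 - (y ^ 2 + (1 - y) * ρc)) := by
    rw [hρc]; exact usage_light_eq y T j (l + r + k) h hy0.le hhj (by rw [← hρc]; exact hρcy)
  have hκa0 : 0 ≤ usage y T j l h := (usage_pos_of_compat y T j l h hy0 hy1 hL0.2 hlh (Or.inr hcompT)).le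
  have hcompT1 : T < ((l + r : ℕ) : ℝ) + h := by rw [hL1r]; linarith [show (0:ℝ) ≤ r from Nat.cast_nonneg r]
  have hcompT2 : T < ((l + r + k : ℕ) : ℝ) + h := by rw [hL2r]; linarith [hK0]
  have hlt1 : l + r < h := by
    have hh : ((l + r : ℕ) : ℝ) < h := by rw [hL1r]; linarith
    exact_mod_cast hh
  have hlt2 : l + r + k < h := by
    have hh : ((l + r + k : ℕ) : ℝ) < h := by rw [hL2r]; linarith
    exact_mod_cast hh
  have hκb0 : 0 ≤ usage y T j (l + r) h := (usage_pos_of_compat y T j (l + r) h hy0 hy1 hL1.2 hlt1 (Or.inr hcompT1)).le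
  have hκc0 : 0 ≤ usage y T j (l + r + k) h :=
    (usage_pos_of_compat y T j (l + r + k) h hy0 hy1 hL2.2 hlt2 (Or.inr hcompT2)).le
  -- the common price bound Q = min(column-A price, pool price)
  obtain ⟨pA, hpA⟩ : ∃ pA : ℝ, pA = if h + r ≤ j then min (p h) (p (h + r)) else p h := ⟨_, rfl⟩
  have hpAh : pA ≤ p h := by rw [hpA]; split_ifs; exacts [min_le_left _ _, le_rfl]
  have rowBound : ∀ (L : ℕ), l ≤ L → L ≤ j ∧ 2 * (L : ℝ) < T → T < (L : ℝ) + h →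
      α L ≤ usage y T j L h * min pA P := by
    intro L hlL hL hLc
    have hLh : L < h := by
      have hh : (L : ℝ) < h := by linarith [hL.2]
      exact_mod_cast hh
    have u0 : 0 ≤ usage y T j L h := (usage_pos_of_compat y T j L h hy0 hy1 hL.2 hLh (Or.inr hLc)).le
    rw [mul_min_of_nonneg _ _ u0]
    refine le_min ?_ ?_
    · -- column A: h itself, and h + r if it is a mid
      have bh : α L ≤ usage y T j L h * p h := hαp L h hL.1 hL.2 (by omega) (Or.inr hLc)
      rw [hpA]; split_ifs with hmid
      · rw [mul_min_of_nonneg _ _ u0]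
        refine le_min bh ?_
        have hLc1 : T < (L : ℝ) + (h + r : ℕ) := by push_cast; linarith [show (0:ℝ) ≤ r from Nat.cast_nonneg r]
        have b1 : α L ≤ usage y T j L (h + r) * p (h + r) := hαp L (h + r) hL.1 hL.2 (by omega) (Or.inr hLc1)
        exact le_trans b1 (mul_le_mul_of_nonneg_right
          (usage_anti_mid y T j L h (h + r) hy0 hy1 (by omega) hmid hL.2 hLc) (hp _))
      · exact bh
    · -- pool: the cheap pseudo-mid at c ≥ h
      have hhc' : (h : ℝ) ≤ c := by exact_mod_cast hhc
      have hLcc : T < (L : ℝ) + c := by linarith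
      have bc := poolB L hL.1 hL.2 hLcc
      rcases Nat.lt_or_ge h c with hlt | hge
      · exact le_trans bc (mul_le_mul_of_nonneg_right (usage_anti_mid y T j L h c hy0 hy1 hlt hcj hL.2 hLc) hP0)
      · have : c = h := le_antisymm hge hhc
        rw [this] at bc; exact bc
  have bA := rowBound l le_rfl hL0 hcompT
  have bB := rowBound (l + r) (by omega) hL1 hcompT1
  have bC := rowBound (l + r + k) (by omega) hL2 hcompT2
  -- Q ≤ the h-copies' prices
  have hQ0 : min pA P ≤ p h := le_trans (min_le_left _ _) hpAh
  have hQ1 : min pA P ≤ p (h + r) := by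
    by_cases hmid : h + r ≤ j
    · have : pA ≤ p (h + r) := by rw [hpA, if_pos hmid]; exact min_le_right _ _
      exact le_trans (min_le_left _ _) this
    · have : q1 = p (h + r) := by rw [hq1d, if_neg hmid]
      exact le_trans (min_le_right _ _) (by rw [← this]; exact hPq1)
  have hQ2 : min pA P ≤ p (h + r + k) := le_trans (min_le_right _ _) hPH2
  -- P2: (1 − γ)·Σ t_s κ_s ≤ γ  via the chord inequality
  have hP2 : (1 - (y ^ 2 + (1 - y) * ρ₀)) * (t0 * usage y T j l h + t1 * usage y T j (l + r) h + t2 * usage y T j (l + r + k) h)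
      ≤ y ^ 2 + (1 - y) * ρ₀ := by
    have main := GluedWindow.p2l y ρ₀ ((h : ℝ) - l) (T - T₀) r ((r : ℝ) + k) t0 t1 t2 hy0 hy1 hρ₀y.le ht0p ht1p ht2p hts
      (Nat.cast_nonneg r) (by linarith [show (0:ℝ) ≤ k from Nat.cast_nonneg k]) (by linarith [hK0, show (1:ℝ) ≤ r by exact_mod_cast hr])
      hdK (by linarith) hΔm
    -- denominators
    have hz0 : 0 < 1 + y - ρ₀ := by linarith
    have eT₀ : T₀ = 2 * (l : ℝ) + ρ₀ * ((h : ℝ) - l) := by rw [hρ₀]; field_simp; ring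
    have ea : (1 + y - ρ₀) * ((h : ℝ) - l) - (T - T₀) = ((h : ℝ) - l) * (1 + y - ρa) := by
      rw [eT₀, hρa]; field_simp; ring
    have eb : (1 + y - ρ₀) * ((h : ℝ) - l) - (T - T₀) + (1 - y) * r = (((h : ℝ) - l) - r) * (1 + y - ρb) := by
      have hne : (h : ℝ) - ((l + r : ℕ) : ℝ) ≠ 0 := by rw [hL1r]; linarith [show (0:ℝ) ≤ k from Nat.cast_nonneg k]
      rw [eT₀, hρb]; field_simp; rw [hL1r]; ring
    have ec : (1 + y - ρ₀) * ((h : ℝ) - l) - (T - T₀) + (1 - y) * ((r : ℝ) + k)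
        = (((h : ℝ) - l) - ((r : ℝ) + k)) * (1 + y - ρc) := by
      have hne : (h : ℝ) - ((l + r + k : ℕ) : ℝ) ≠ 0 := by rw [hL2r]; linarith
      rw [eT₀, hρc]; field_simp; rw [hL2r]; ring
    rw [ec, eb, ea] at main
    have hza : 0 < 1 + y - ρa := by linarith
    have hzb : 0 < 1 + y - ρb := by linarith
    have hzc : 0 < 1 + y - ρc := by linarith
    have hdb : (0:ℝ) < ((h : ℝ) - l) - r := by linarith [show (0:ℝ) ≤ k from Nat.cast_nonneg k]
    have hdc : (0:ℝ) < ((h : ℝ) - l) - ((r : ℝ) + k) := by linarith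
    have qa : ((h : ℝ) - l) / (((h : ℝ) - l) * (1 + y - ρa)) = 1 / (1 + y - ρa) := by
      field_simp
    have qb : (((h : ℝ) - l) - r) / ((((h : ℝ) - l) - r) * (1 + y - ρb)) = 1 / (1 + y - ρb) := by
      field_simp
    have qc : (((h : ℝ) - l) - ((r : ℝ) + k)) / ((((h : ℝ) - l) - ((r : ℝ) + k)) * (1 + y - ρc)) = 1 / (1 + y - ρc) := by
      field_simp
    rw [qa, qb, qc] at main
    -- main : t0 * (1/(1+y−ρa)) + t1 * (1/(1+y−ρb)) + t2 * (1/(1+y−ρc)) ≤ 1/(1+y−ρ₀) … up to the shape `d/(d z) = 1/z`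
    rw [eκa, eκb, eκc]
    have fa : (y ^ 2 + (1 - y) * ρa) / (1 - (y ^ 2 + (1 - y) * ρa)) = 1 / ((1 - y) * (1 + y - ρa)) - 1 := by
      have e1 : 1 - (y ^ 2 + (1 - y) * ρa) = (1 - y) * (1 + y - ρa) := by ring
      have hne : (1 - y) * (1 + y - ρa) ≠ 0 := by positivity
      rw [e1, eq_sub_iff_add_eq, div_add_one hne]
      congr 1; ring
    have fb : (y ^ 2 + (1 - y) * ρb) / (1 - (y ^ 2 + (1 - y) * ρb)) = 1 / ((1 - y) * (1 + y - ρb)) - 1 := by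
      have e1 : 1 - (y ^ 2 + (1 - y) * ρb) = (1 - y) * (1 + y - ρb) := by ring
      have hne : (1 - y) * (1 + y - ρb) ≠ 0 := by positivity
      rw [e1, eq_sub_iff_add_eq, div_add_one hne]
      congr 1; ring
    have fc : (y ^ 2 + (1 - y) * ρc) / (1 - (y ^ 2 + (1 - y) * ρc)) = 1 / ((1 - y) * (1 + y - ρc)) - 1 := by
      have e1 : 1 - (y ^ 2 + (1 - y) * ρc) = (1 - y) * (1 + y - ρc) := by ring
      have hne : (1 - y) * (1 + y - ρc) ≠ 0 := by positivity
      rw [e1, eq_sub_iff_add_eq, div_add_one hne]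
      congr 1; ring
    rw [fa, fb, fc]
    have key : (1 + y - ρ₀) * (t0 * (1 / (1 + y - ρa)) + t1 * (1 / (1 + y - ρb)) + t2 * (1 / (1 + y - ρc))) ≤ 1 := by
      have := mul_le_mul_of_nonneg_left main hz0.le
      rwa [mul_one_div_cancel hz0.ne'] at this
    have eG : 1 - (y ^ 2 + (1 - y) * ρ₀) = (1 - y) * (1 + y - ρ₀) := by ring
    have expand : (1 - y) * (1 + y - ρ₀) * (t0 * (1 / ((1 - y) * (1 + y - ρa)) - 1)
          + t1 * (1 / ((1 - y) * (1 + y - ρb)) - 1) + t2 * (1 / ((1 - y) * (1 + y - ρc)) - 1))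
        = (1 + y - ρ₀) * (t0 * (1 / (1 + y - ρa)) + t1 * (1 / (1 + y - ρb)) + t2 * (1 / (1 + y - ρc)))
          - (1 - y) * (1 + y - ρ₀) * (t0 + t1 + t2) := by
      field_simp
      ring
    rw [eG, expand, hts]
    linarith
  -- assembly
  have hγ0 : 0 ≤ y ^ 2 + (1 - y) * ρ₀ := by
    have : 0 ≤ ρ₀ := by rw [hρ₀]; exact div_nonneg (by linarith) hd0.le
    positivity
  have hγ1 : 0 ≤ 1 - (y ^ 2 + (1 - y) * ρ₀) := by nlinarith
  have hpA0 : 0 ≤ pA := by rw [hpA]; split_ifs; exacts [le_min (hp _) (hp _), hp _]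
  have hQnn : 0 ≤ min pA P := le_min hpA0 hP0
  rw [eΨl, eΨh, hγ]
  have s1 : t0 * α l + t1 * α (l + r) + t2 * α (l + r + k)
      ≤ (t0 * usage y T j l h + t1 * usage y T j (l + r) h + t2 * usage y T j (l + r + k) h) * min pA P := by
    have e1 := mul_le_mul_of_nonneg_left bA ht0p
    have e2 := mul_le_mul_of_nonneg_left bB ht1p
    have e3 := mul_le_mul_of_nonneg_left bC ht2p
    linarith
  have s2 : (1 - (y ^ 2 + (1 - y) * ρ₀))
      * ((t0 * usage y T j l h + t1 * usage y T j (l + r) h + t2 * usage y T j (l + r + k) h) * min pA P)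
      ≤ (y ^ 2 + (1 - y) * ρ₀) * min pA P := by
    have := mul_le_mul_of_nonneg_right hP2 hQnn
    linarith [this]
  have s3 : (t0 + t1 + t2) * min pA P ≤ t0 * p h + t1 * p (h + r) + t2 * p (h + r + k) := by
    have e1 := mul_le_mul_of_nonneg_left hQ0 ht0p
    have e2 := mul_le_mul_of_nonneg_left hQ1 ht1p
    have e3 := mul_le_mul_of_nonneg_left hQ2 ht2p
    linarith
  rw [hts, one_mul] at s3
  have f1 := mul_le_mul_of_nonneg_left s1 hγ1
  have f3 := mul_le_mul_of_nonneg_left s3 hγ0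
  linarith

end LawDec
end Quant
end Summit.CriticalPhenomena.PercolationContinuityZ3.Theorems
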